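import Summits.HodgeConjecture.HodgeConjecture.Theorems.R90S9ChiExpansionAtGammaSph   -- ★ p862518 (this seat): `chiExpansion_gammaSph_of_allClasses`, `trGp₀_tens₀_eq_zero_of_not_isKcSphericalClass`
import Summits.HodgeConjecture.HodgeConjecture.Theorems.R90S9TestPairPins              -- ★ p862626 (this seat): `trPrime_pin_eq_trGp₀_tensOfPair`; cone ★ p862596 `tensOfPair`, `tensOfPair_eq_tens₀`, ★ p862412 `tupleOf`
import HarnessLib

/-!
# R90-TF · S9 «InnerForm-13.3.6 (c)» — J10 AT THE PINS OF RECORD: the guarded spectral expansion `hχ𝓕` at `gammaSph X` on the BARE test pairs, from the ALL-CLASSES law at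
# `tensOfPair p` and the pin `X.trPrime = Θ₀ ∘ tupleOf` (Rogawski 1990 §14.6 p. 244, §14.2 pp. 232–233)

Cell `hodgecm-mathlib`, crux H413 (`stmt-HodgeConjecture-24833`, lane `--supports … --as helper`), route of record `HCCMUnconditional` (count-neutral).  Programme R90-TF,
section S9 (base `R90-IF`); seat R90-IF-p05 (g0); default hand after RULING S9-R-TG-4 (R90-IF-plan 22:34:18Z: `X_cm` on the BARE pair type, `X_cm.traceL := fun p =>
𝔨.traceGp (tensOfPair … p)`, `X_cm.trPrime := fun π′ p => Θ₀ (tupleOf … π′) p`; J10 = the ALL-CLASSES kit law at the realised test).  THEOREMS ONLY (no `def`, no instance, no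
notation, no named fact, no `sorry`); never imports a `Cruxes/…/Lines` module; namespace `Summit.HodgeConjecture.HodgeConjecture.R90.S9`.
HONEST LABEL: HC_CM is proved only modulo the 7 printed citations (2 remaining named inputs: hLiu418 = stmt-HodgeConjecture-24832, h413 = stmt-HodgeConjecture-24833)
— until rung 0 closes.  CONDITIONAL on the letter «ArchFinTraceSplit» + PH (through ★ p862626 ∕ ★ p862596 §4 ∕ ★ p862484, named hypotheses); bookkeeping composition, proves
no printed statement.

## CONTENTS (all proved; axioms TRIO)
**`chiExpansion_gammaSph_of_allClasses_tensOfPair`** — for a datum bundle `X` over the BARE pair type `TG′ = (G′_∞ → ℂ) × (∀ v, G′_v → ℂ)` (★ p862404 `DatumInputs`, generic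
otherwise), a guard `𝓕` INSIDE the test predicate `𝓕₀` (`h𝓕₀`), the ALL-CLASSES LAW at the realised test (`hspecAll : 𝓕 p → Summable (c ↦ m′ c · trGp₀ c (tensOfPair p)) ∧
X.traceL p = Σ' c, …` — J10, T1∕S8's discrete-spectrum law for the compact quotient read at `f′ := tensOfPair p`), and the PIN `htrX : X.trPrime π′ p = Θ₀ (tupleOf π′) p`
(`rfl` at `X_cm`): p04 (g2)'s binder `hχ𝓕` at `Γ := gammaSph … X`, bytes verbatim.  Proof = ★ p862518 `chiExpansion_gammaSph_of_allClasses` at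
`χ c p := trGp₀ … c (tensOfPair p)` with `hvan` := ★ `trGp₀_tens₀_eq_zero_of_not_isKcSphericalClass` through ★ `tensOfPair_eq_tens₀` (PH ⇒ `ν` Haar ⇒ left invariant) and
`htr` := ★ p862626 `trPrime_pin_eq_trGp₀_tensOfPair`.  `_levels`: the level-indexed form (★ p862431's binder shape).
[cite: Rogawski1990, §14.6 Thm. 14.6.4 p. 244; §14.2 pp. 232–233; §14.5 p. 237] [cite: BorelJacquet1979, §4.1 and §4.6] [cite: FlathCorvallis1979, Thm. 3 and Thm. 4]
-/

set_option autoImplicit false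
-- the mandated namespace repeats `HodgeConjecture.HodgeConjecture`, as in every `Theorems/*.lean` of this sub-problem
set_option linter.dupNamespace false

noncomputable section

open NumberField IsDedekindDomain MeasureTheory Filter
open scoped Matrix MatrixGroups Classical
open Literature.NumberTheory Literature.NumberTheory.Automorphic Literature.NumberTheory.Automorphic.UnitaryGroup
open Literature.NumberTheory.Automorphic.UnitaryGroup.CotangentForms
open Literature.NumberTheory.Rogawski1990
open Summit.HodgeConjecture.HodgeConjecture.Cruxes.H413
open Summit.HodgeConjecture.HodgeConjecture.Cruxes.H413.F0P3InnerFormClassificationV6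
open Summit.HodgeConjecture.HodgeConjecture.Cruxes.H413.F0P3ClassTokensOfRecord (Cls cl rep)
open Summit.HodgeConjecture.HodgeConjecture.Cruxes.H413.F0P3SpectralSideOfRecord (trGp₀)
open Summit.HodgeConjecture.HodgeConjecture.Cruxes.H413.F0P3LettersTraceFactorisation (IsProductHaar)
open Summit.HodgeConjecture.HodgeConjecture.Cruxes.H413.F0P3LettersArchFinTraceSplit (ArchFinTraceSplit)
open Summit.HodgeConjecture.HodgeConjecture.Cruxes.H413.F0P3GlobalPacket Summit.HodgeConjecture.HodgeConjecture.Cruxes.H413.F0P3LocalPacketKit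

namespace Summit.HodgeConjecture.HodgeConjecture.R90.S9

open InnerFormSec146

variable (TG TH : Type) (L : Type) [Field L] [NumberField L] [IsCMField L] (ι : L →+* ℂ) (H : Matrix (Fin 3) (Fin 3) L) (T : GL (Fin 3) ℂ)
  (hT : (T : Matrix (Fin 3) (Fin 3) ℂ)ᴴ * H.map ι * (T : Matrix (Fin 3) (Fin 3) ℂ) = Literature.Geometry.ComplexHyperbolic.BallModel.J)
  (μA : Measure (adelicGroupData (↥(maximalRealSubfield L)) L (IsCMField.complexConj L) 3 H).automorphicQuotient)
  [(adelicGroupData (↥(maximalRealSubfield L)) L (IsCMField.complexConj L) 3 H).IsAutomorphicMeasure μA]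
  (Ξ : OneDimAutRepH L → PacketPrimeFin L H) {H' : Matrix (Fin 3) (Fin 3) L}
  (𝔩 : ∀ v : HeightOneSpectrum (𝓞 ↥(maximalRealSubfield L)), LocalPacketKit L H' v)
  (X : DatumInputs
    ((UnitaryGroup.arch (↥(maximalRealSubfield L)) L (IsCMField.complexConj L) 3 H → ℂ) × (∀ v : Places L, (cmDatum L 3 H).Local v → ℂ))
    TG TH L ι H T hT μA Ξ 𝔩)
  [MeasurableSpace (Gp L H).Adelic] [BorelSpace (Gp L H).Adelic] (ν : Measure (Gp L H).Adelic) [IsFiniteMeasureOnCompacts ν]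
  (νinf : @Measure (UnitaryGroup.arch (↥(maximalRealSubfield L)) L (IsCMField.complexConj L) 3 H) (borel _))
  (μv : ∀ v : Places L, @Measure ((cmDatum L 3 H).Local v) (borel _))

/-- **J10 AT THE PINS OF RECORD — the guarded spectral expansion `hχ𝓕` at `gammaSph X` on the bare test pairs** (p04 (g2)'s binder of ★ p862413 at `Γ := gammaSph … X`,
bytes verbatim), from: the guard `𝓕` inside the test predicate (`h𝓕₀`), the ALL-CLASSES LAW at the realised test `tensOfPair p` (`hspecAll`, junction J10), and the pin
`htrX : X.trPrime π′ p = Θ₀ (tupleOf π′) p` (`rfl` at `X_cm`).  The non-spherical classes drop out (★ `trGp₀_tens₀_eq_zero_of_not_isKcSphericalClass` after ★ `tensOfPair_eq_tens₀`;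
`ν` is Haar by PH), the sum re-indexes along `Rep′_sph ↪ Rep′` (★ p862518), and `tr′ = trGp₀ ∘ tensOfPair` on the scope (★ p862626).  Modulo «ArchFinTraceSplit» + PH; `H` anisotropic.
[cite: Rogawski1990, §14.6 Thm. 14.6.4 p. 244; §14.2 pp. 232–233] [cite: BorelJacquet1979, §4.6] [cite: FlathCorvallis1979, Thm. 3 and Thm. 4] -/
theorem chiExpansion_gammaSph_of_allClasses_tensOfPair
    (hanis : ∀ x : Fin 3 → L, Literature.AlgebraicGeometry.ShimuraVarieties.hermForm (cmConjRingHom L) H x x = 0 → x = 0)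
    (hAFS : ArchFinTraceSplit L H ι T hT μA ν νinf μv) (hPH : IsProductHaar L H ν νinf μv)
    (𝓕 : (UnitaryGroup.arch (↥(maximalRealSubfield L)) L (IsCMField.complexConj L) 3 H → ℂ) × (∀ v : Places L, (cmDatum L 3 H).Local v → ℂ) → Prop)
    (h𝓕₀ : ∀ p, 𝓕 p → ArchTestKc L ι H T hT p.1 ∧ (∀ v : Places L, IsLocallyConstant (p.2 v) ∧ HasCompactSupport (p.2 v)) ∧
      {v : Places L | p.2 v ≠ (cmLocalIntegralLevel L 3 H v : Set ((cmDatum L 3 H).Local v)).indicator fun _ => (1 : ℂ)}.Finite)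
    (hspecAll : ∀ p, 𝓕 p →
      Summable (fun c : RepPrimeClass L H μA => (mPrime L H μA c : ℂ) * trGp₀ (Gp L H) μA ν c (tensOfPair L H ι T hT p)) ∧
        X.traceL p = ∑' c : RepPrimeClass L H μA, (mPrime L H μA c : ℂ) * trGp₀ (Gp L H) μA ν c (tensOfPair L H ι T hT p))
    (htrX : ∀ (π' : RepPrimeSph L ι H T hT μA) (p : (UnitaryGroup.arch (↥(maximalRealSubfield L)) L (IsCMField.complexConj L) 3 H → ℂ) ×
        (∀ v : Places L, (cmDatum L 3 H).Local v → ℂ)),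
      X.trPrime π' p = UnitaryGroup.archTr₀ L ι H T hT νinf (tupleOf L ι H T hT μA π').1 p.1 *
        ∏ᶠ v : Places L, (letI : MeasurableSpace ((cmDatum L 3 H).Local v) := borel _;
          ((tupleOf L ι H T hT μA π').2 v).smoothTrace (μv v) (p.2 v))) :
    ∀ p, 𝓕 p →
      Summable (fun π' : (gammaSph _ TG TH L ι H T hT μA Ξ 𝔩 X).Rep' =>
          ((gammaSph _ TG TH L ι H T hT μA Ξ 𝔩 X).m' π' : ℂ) * (gammaSph _ TG TH L ι H T hT μA Ξ 𝔩 X).tr' π' p) ∧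
        (gammaSph _ TG TH L ι H T hT μA Ξ 𝔩 X).traceL p =
          ∑' π' : (gammaSph _ TG TH L ι H T hT μA Ξ 𝔩 X).Rep',
            ((gammaSph _ TG TH L ι H T hT μA Ξ 𝔩 X).m' π' : ℂ) * (gammaSph _ TG TH L ι H T hT μA Ξ 𝔩 X).tr' π' p := by
  haveI : ν.IsHaarMeasure := hPH.1
  refine chiExpansion_gammaSph_of_allClasses _ TG TH L ι H T hT μA Ξ 𝔩 X 𝓕
    (fun c p => trGp₀ (Gp L H) μA ν c (tensOfPair L H ι T hT p)) hspecAll (fun p hp c hc => ?_) (fun π' p hp => ?_)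
  · -- vanishing off the scope: realise `p` on its canonical bad set and use ★ (D)
    have h := h𝓕₀ p hp
    have h₁ : ∀ v : Places L, v ∉ h.2.2.toFinset →
        p.2 v = (cmLocalIntegralLevel L 3 H v : Set ((cmDatum L 3 H).Local v)).indicator fun _ => (1 : ℂ) := by
      intro v hv
      by_contra hne
      exact hv (h.2.2.mem_toFinset.2 hne)
    show trGp₀ (Gp L H) μA ν c (tensOfPair L H ι T hT p) = 0
    rw [tensOfPair_eq_tens₀ L H ι T hT h h.2.2.toFinset h₁]
    exact trGp₀_tens₀_eq_zero_of_not_isKcSphericalClass L ι H T hT μA ν h.2.2.toFinset c _ _ hc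
  · -- the pin: `X.trPrime π′ p = trGp₀ π′.1 (tensOfPair p)` on the test predicate
    exact trPrime_pin_eq_trGp₀_tensOfPair L H ι T hT μA ν νinf μv hanis hAFS hPH X.trPrime htrX π' p (h𝓕₀ p hp)

/-- **LEVEL-INDEXED FORM** (★ p862431's binder shape `𝓕 : Λ → TG′ → Prop`): the same, levelwise. [cite: Rogawski1990, §14.6 Thm. 14.6.4 p. 244; §14.2 pp. 232–233] -/
theorem chiExpansion_gammaSph_of_allClasses_tensOfPair_levels
    (hanis : ∀ x : Fin 3 → L, Literature.AlgebraicGeometry.ShimuraVarieties.hermForm (cmConjRingHom L) H x x = 0 → x = 0)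
    (hAFS : ArchFinTraceSplit L H ι T hT μA ν νinf μv) (hPH : IsProductHaar L H ν νinf μv)
    {Λ : Type*} (𝓕 : Λ → (UnitaryGroup.arch (↥(maximalRealSubfield L)) L (IsCMField.complexConj L) 3 H → ℂ) × (∀ v : Places L, (cmDatum L 3 H).Local v → ℂ) → Prop)
    (h𝓕₀ : ∀ l p, 𝓕 l p → ArchTestKc L ι H T hT p.1 ∧ (∀ v : Places L, IsLocallyConstant (p.2 v) ∧ HasCompactSupport (p.2 v)) ∧
      {v : Places L | p.2 v ≠ (cmLocalIntegralLevel L 3 H v : Set ((cmDatum L 3 H).Local v)).indicator fun _ => (1 : ℂ)}.Finite)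
    (hspecAll : ∀ l p, 𝓕 l p →
      Summable (fun c : RepPrimeClass L H μA => (mPrime L H μA c : ℂ) * trGp₀ (Gp L H) μA ν c (tensOfPair L H ι T hT p)) ∧
        X.traceL p = ∑' c : RepPrimeClass L H μA, (mPrime L H μA c : ℂ) * trGp₀ (Gp L H) μA ν c (tensOfPair L H ι T hT p))
    (htrX : ∀ (π' : RepPrimeSph L ι H T hT μA) (p : (UnitaryGroup.arch (↥(maximalRealSubfield L)) L (IsCMField.complexConj L) 3 H → ℂ) ×
        (∀ v : Places L, (cmDatum L 3 H).Local v → ℂ)),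
      X.trPrime π' p = UnitaryGroup.archTr₀ L ι H T hT νinf (tupleOf L ι H T hT μA π').1 p.1 *
        ∏ᶠ v : Places L, (letI : MeasurableSpace ((cmDatum L 3 H).Local v) := borel _;
          ((tupleOf L ι H T hT μA π').2 v).smoothTrace (μv v) (p.2 v))) :
    ∀ l p, 𝓕 l p →
      Summable (fun π' : (gammaSph _ TG TH L ι H T hT μA Ξ 𝔩 X).Rep' =>
          ((gammaSph _ TG TH L ι H T hT μA Ξ 𝔩 X).m' π' : ℂ) * (gammaSph _ TG TH L ι H T hT μA Ξ 𝔩 X).tr' π' p) ∧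
        (gammaSph _ TG TH L ι H T hT μA Ξ 𝔩 X).traceL p =
          ∑' π' : (gammaSph _ TG TH L ι H T hT μA Ξ 𝔩 X).Rep',
            ((gammaSph _ TG TH L ι H T hT μA Ξ 𝔩 X).m' π' : ℂ) * (gammaSph _ TG TH L ι H T hT μA Ξ 𝔩 X).tr' π' p :=
  fun l => chiExpansion_gammaSph_of_allClasses_tensOfPair TG TH L ι H T hT μA Ξ 𝔩 X ν νinf μv hanis hAFS hPH (𝓕 l) (h𝓕₀ l) (hspecAll l) htrX

end Summit.HodgeConjecture.HodgeConjecture.R90.S9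

end
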